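import Literature.NumberTheory.GaloisCohomology.PBasisKaehler
import Literature.NumberTheory.GaloisCohomology.FrobeniusTwistBasis
import Literature.NumberTheory.GaloisCohomology.FrobeniusDeRham
import Literature.AlgebraicGeometry.Crystalline.IotaMulInsert
import HarnessLib

/-!
# The twisted monomial basis of the de Rham complex of a ring with a `p`-basis

For a ring `R` of characteristic `p` with a finite `p`-basis `t : ι → R` (`IsPBasis p t`), `ι` linearly
ordered, the module of `n`-forms `Ωⁿ_R = ⋀ⁿ Ω[R⁄ℤ]` viewed through Frobenius (`FrobeniusTwist p R Ωⁿ_R`,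
`c • ω = c^p ω`) is FREE on the **monomial vectors**

  `E (α, s) = t^α • dt_s`,  `α : ι → Fin p`, `s ⊆ ι` of size `n`, `dt_s = dt_{s₁} ∧ ⋯ ∧ dt_{sₙ}` increasing,

(`IsPBasis.twistFormBasis`, from `FrobeniusTwist.basisProd` of the `p`-monomial basis and `IsPBasis.formBasis`);
the exterior derivative is `R`-LINEAR for the twisted structures (`dTwist p R n`, `d (c^p ω) = c^p dω`) and
maps monomial vectors to INTEGER combinations of monomial vectors:

  `d (t^α • dt_s) = ∑ i, (α_i * t^(α - e_i)) • (dt_i ∧ dt_s)`   (`kaehlerExteriorDerivative_pMonomial_smul_formBasis`)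

— the "constant coefficients" phenomenon behind the Cartier isomorphism (file `CartierIsomorphism.lean`,
where `dt_i ∧ dt_s = ± dt_{insert i s}` is inserted and the complex is decomposed by weights).

## References

* L. Illusie, *Complexe de de Rham–Witt et cohomologie cristalline*, Ann. Sci. ÉNS 12 (1979), 0.2. [Illusie1979]
* N. Katz, *Nilpotent connections and the monodromy theorem*, Publ. IHÉS 39 (1970), Thm. 7.2. [folklore]
-/

noncomputable section

open scoped BigOperators
open KaehlerDifferential (D)
open Literature.AlgebraicGeometry.Crystalline (ιMul coe_ιMul insertSign ιMul_ιMulti_family_of_not_mem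
  ιMul_ιMulti_family_of_mem)
open Literature.AlgebraicGeometry.Crystalline.KaehlerExteriorDerivative
  (kaehlerExteriorDerivative kaehlerExteriorDerivative_smul kaehlerExteriorDerivative_ιMulti_D
    kaehlerExteriorDerivative_kaehlerExteriorDerivative)

namespace Literature.NumberTheory.GaloisCohomology

universe u v

/-! ### The twisted exterior derivative -/

section DTwist

variable (p : ℕ) [hp : Fact p.Prime] (R : Type u) [CommRing R] [CharP R p]

/-- **The exterior derivative as an `R`-linear map of Frobenius twists**,
`dTwist p R n : FrobeniusTwist p R Ωⁿ_R →ₗ[R] FrobeniusTwist p R Ωⁿ⁺¹_R` (`d (c^p • ω) = c^p • d ω`). [folklore] -/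
def dTwist (n : ℕ) :
    FrobeniusTwist p R (⋀[R]^n (Ω[R⁄ℤ])) →ₗ[R] FrobeniusTwist p R (⋀[R]^(n + 1) (Ω[R⁄ℤ])) where
  toFun x := FrobeniusTwist.of p R (kaehlerExteriorDerivative ℤ R n ((FrobeniusTwist.of p R).symm x))
  map_add' x y := by rw [map_add, map_add, map_add]
  map_smul' c x := by
    rw [FrobeniusTwist.of_symm_smul, kaehlerExteriorDerivative_pow_char_smul, RingHom.id_apply,
      FrobeniusTwist.smul_of]

/-- `dTwist` is `d` on underlying forms. [folklore] -/
@[simp] theorem of_symm_dTwist (n : ℕ) (x : FrobeniusTwist p R (⋀[R]^n (Ω[R⁄ℤ]))) :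
    (FrobeniusTwist.of p R).symm (dTwist p R n x) =
      kaehlerExteriorDerivative ℤ R n ((FrobeniusTwist.of p R).symm x) :=
  rfl

/-- `dTwist (of ω) = of (d ω)`. [folklore] -/
theorem dTwist_of (n : ℕ) (ω : ⋀[R]^n (Ω[R⁄ℤ])) :
    dTwist p R n (FrobeniusTwist.of p R ω) = FrobeniusTwist.of p R (kaehlerExteriorDerivative ℤ R n ω) :=
  rfl

/-- **`d ∘ d = 0`** for the twisted derivative. [folklore] -/
theorem dTwist_dTwist (n : ℕ) (x : FrobeniusTwist p R (⋀[R]^n (Ω[R⁄ℤ]))) :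
    dTwist p R (n + 1) (dTwist p R n x) = 0 := by
  apply (FrobeniusTwist.of p R).symm.injective
  rw [of_symm_dTwist, of_symm_dTwist, kaehlerExteriorDerivative_kaehlerExteriorDerivative, map_zero]

/-- `d ∘ d = 0` as a composition of linear maps. [folklore] -/
theorem dTwist_comp_dTwist (n : ℕ) : dTwist p R (n + 1) ∘ₗ dTwist p R n = 0 :=
  LinearMap.ext (dTwist_dTwist p R n)

/-- The kernel of `dTwist` is the submodule of closed forms `closedTwist`. [folklore] -/
theorem ker_dTwist (n : ℕ) : LinearMap.ker (dTwist p R n) = closedTwist p R n := by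
  ext x
  rw [LinearMap.mem_ker, mem_closedTwist_iff]
  constructor
  · intro hx
    have := congrArg (FrobeniusTwist.of p R).symm hx
    rwa [of_symm_dTwist, map_zero] at this
  · intro hx
    apply (FrobeniusTwist.of p R).symm.injective
    rw [of_symm_dTwist, hx, map_zero]

/-- The range of `dTwist` is the submodule of exact forms `exactTwist` (positive degree). [folklore] -/
theorem range_dTwist (n : ℕ) : LinearMap.range (dTwist p R n) = exactTwist p R (n + 1) := by
  ext x
  rw [LinearMap.mem_range, mem_exactTwist_iff, mem_exactForms_succ_iff]
  constructor
  · rintro ⟨y, rfl⟩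
    exact ⟨(FrobeniusTwist.of p R).symm y, rfl⟩
  · rintro ⟨η, hη⟩
    exact ⟨FrobeniusTwist.of p R η, (FrobeniusTwist.of p R).symm.injective (by rw [of_symm_dTwist]; exact hη)⟩

end DTwist

/-! ### Sums in the one-form slot of `ιMul` -/

section IotaMul

variable {R : Type u} [CommRing R]

/-- `ιMul` is additive in the one-form over finite sums. [folklore] -/
theorem ιMul_sum_left {κ : Type*} (n : ℕ) (S : Finset κ) (θ : κ → Ω[R⁄ℤ]) (ω : ⋀[R]^n (Ω[R⁄ℤ])) :
    ιMul n (∑ k ∈ S, θ k) ω = ∑ k ∈ S, ιMul n (θ k) ω := by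
  classical
  induction S using Finset.induction_on with
  | empty =>
    rw [Finset.sum_empty, Finset.sum_empty]
    exact Subtype.ext (by rw [coe_ιMul, map_zero, zero_mul, Submodule.coe_zero])
  | insert a S ha ih => rw [Finset.sum_insert ha, Finset.sum_insert ha, ιMul_add_left, ih]

/-- `ιMul` of a finite `R`-combination of one-forms. [folklore] -/
theorem ιMul_sum_smul_left {κ : Type*} (n : ℕ) (S : Finset κ) (c : κ → R) (θ : κ → Ω[R⁄ℤ])
    (ω : ⋀[R]^n (Ω[R⁄ℤ])) :
    ιMul n (∑ k ∈ S, c k • θ k) ω = ∑ k ∈ S, c k • ιMul n (θ k) ω := by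
  rw [ιMul_sum_left]
  exact Finset.sum_congr rfl fun k _ => ιMul_smul_left n (c k) (θ k) ω

end IotaMul

/-! ### The twisted monomial basis of `Ωⁿ_R` -/

namespace IsPBasis

variable {p : ℕ} [hp : Fact p.Prime] {R : Type u} [CommRing R] [CharP R p] {ι : Type v} [Fintype ι]
  [LinearOrder ι] {t : ι → R}

/-- **The twisted monomial basis of `Ωⁿ_R`**: the `R`-basis of `FrobeniusTwist p R (⋀ⁿ Ω[R⁄ℤ])` indexed by
pairs `(α, s)` (`α : ι → Fin p`, `s` an `n`-element subset of `ι`), with vectors `t^α • dt_s`.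
[cite: Illusie1979, 0.2] -/
def twistFormBasis (h : IsPBasis p t) (n : ℕ) :
    Module.Basis ((ι → Fin p) × Set.powersetCard ι n) R (FrobeniusTwist p R (⋀[R]^n (Ω[R⁄ℤ]))) :=
  FrobeniusTwist.basisProd p h.basis (h.formBasis n)

/-- The vectors of the twisted monomial basis: `E (α, s) = of (t^α • dt_s)`. [folklore] -/
@[simp] theorem twistFormBasis_apply (h : IsPBasis p t) (n : ℕ) (α : ι → Fin p) (s : Set.powersetCard ι n) :
    h.twistFormBasis n (α, s) = FrobeniusTwist.of p R (pMonomial p t α • h.formBasis n s) := by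
  rw [twistFormBasis, FrobeniusTwist.basisProd_apply, h.basis_apply]
  rfl

/-- The underlying form of `E (α, s)` is `t^α • dt_s`. [folklore] -/
theorem of_symm_twistFormBasis_apply (h : IsPBasis p t) (n : ℕ) (α : ι → Fin p)
    (s : Set.powersetCard ι n) :
    (FrobeniusTwist.of p R).symm (h.twistFormBasis n (α, s)) = pMonomial p t α • h.formBasis n s := by
  rw [twistFormBasis_apply]
  rfl

/-! ### The exterior derivative on monomial vectors -/

/-- `d (dt_s) = 0`: the basis forms `dt_s` are closed. [folklore] -/
theorem kaehlerExteriorDerivative_formBasis (h : IsPBasis p t) (n : ℕ) (s : Set.powersetCard ι n) :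
    kaehlerExteriorDerivative ℤ R n (h.formBasis n s) = 0 := by
  rw [formBasis_apply, exteriorPower.ιMulti_family]
  exact kaehlerExteriorDerivative_ιMulti_D ℤ R n (t ∘ (Set.powersetCard.ofFinEmbEquiv.symm s))

/-- **`d (t^α • dt_s) = ∑ i, (α_i t^(α - e_i)) • (dt_i ∧ dt_s)`** — the exterior derivative of a monomial
vector, before sorting `dt_i ∧ dt_s`. [cite: Illusie1979, 0.2] -/
theorem kaehlerExteriorDerivative_pMonomial_smul_formBasis (h : IsPBasis p t) (n : ℕ) (α : ι → Fin p)
    (s : Set.powersetCard ι n) :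
    kaehlerExteriorDerivative ℤ R n (pMonomial p t α • h.formBasis n s) =
      ∑ i, (((α i : ℕ) : R) * pMonomial p t (α - Pi.single i 1)) •
        ιMul n (D ℤ R (t i)) (h.formBasis n s) := by
  rw [kaehlerExteriorDerivative_smul, h.kaehlerExteriorDerivative_formBasis, smul_zero, add_zero,
    h.D_pMonomial, ιMul_sum_smul_left]

/-- The same formula for the twisted derivative of a basis vector:
`dTwist (E (α, s)) = of (∑ i, (α_i t^(α - e_i)) • (dt_i ∧ dt_s))`. [cite: Illusie1979, 0.2] -/
theorem dTwist_twistFormBasis_eq_of_sum (h : IsPBasis p t) (n : ℕ) (α : ι → Fin p)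
    (s : Set.powersetCard ι n) :
    dTwist p R n (h.twistFormBasis n (α, s)) =
      FrobeniusTwist.of p R (∑ i, (((α i : ℕ) : R) * pMonomial p t (α - Pi.single i 1)) •
        ιMul n (D ℤ R (t i)) (h.formBasis n s)) := by
  rw [twistFormBasis_apply, dTwist_of, kaehlerExteriorDerivative_pMonomial_smul_formBasis]

/-! ### Sorting `dt_i ∧ dt_s`: the matrix of `d` in the monomial basis is integral -/

omit hp [CharP R p] [Fintype ι] in
/-- The `(n+1)`-element index set `insert i s` of a d-move (`i ∉ s`). [folklore] -/
def insertIdx {n : ℕ} (s : Set.powersetCard ι n) (i : ι) (hi : i ∉ (s : Finset ι)) :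
    Set.powersetCard ι (n + 1) :=
  ⟨insert i (s : Finset ι), Set.powersetCard.mem_iff.mpr
    (by rw [Finset.card_insert_of_notMem hi, Set.powersetCard.card_eq])⟩

omit hp [CharP R p] [Fintype ι] in
/-- The underlying finset of `insertIdx s i hi` is `insert i s`. [folklore] -/
@[simp] theorem coe_insertIdx {n : ℕ} (s : Set.powersetCard ι n) (i : ι) (hi : i ∉ (s : Finset ι)) :
    ((insertIdx s i hi : Set.powersetCard ι (n + 1)) : Finset ι) = insert i (s : Finset ι) :=
  rfl

/-- **`dt_i ∧ dt_s = ε(s, i) • dt_{insert i s}`** for `i ∉ s` (`ε(s,i) = (-1)^{#{j ∈ s | j < i}}`). [folklore] -/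
theorem ιMul_D_formBasis_of_not_mem (h : IsPBasis p t) (n : ℕ) (s : Set.powersetCard ι n) (i : ι)
    (hi : i ∉ (s : Finset ι)) :
    ιMul n (D ℤ R (t i)) (h.formBasis n s) =
      ((insertSign (s : Finset ι) i : ℤˣ) : ℤ) • h.formBasis (n + 1) (insertIdx s i hi) := by
  rw [formBasis_apply, formBasis_apply]
  exact ιMul_ιMulti_family_of_not_mem (fun j => D ℤ R (t j)) s i hi

/-- `dt_i ∧ dt_s = 0` for `i ∈ s`. [folklore] -/
theorem ιMul_D_formBasis_of_mem (h : IsPBasis p t) (n : ℕ) (s : Set.powersetCard ι n) (i : ι)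
    (hi : i ∈ (s : Finset ι)) : ιMul n (D ℤ R (t i)) (h.formBasis n s) = 0 := by
  rw [formBasis_apply]
  exact ιMul_ιMulti_family_of_mem (fun j => D ℤ R (t j)) s i hi

/-- Scalar bookkeeping: `((a : R) * m) • (z • ω) = ((a : ℤ) * z) • (m • ω)` for `a : ℕ`, `z : ℤ`. [folklore] -/
private theorem natCast_mul_smul_zsmul {N : Type*} [AddCommGroup N] [Module R N] (a : ℕ) (m : R) (z : ℤ)
    (ω : N) : ((a : R) * m) • (z • ω) = ((a : ℤ) * z) • (m • ω) := by
  rw [mul_smul, smul_comm m z ω, Nat.cast_smul_eq_nsmul R a, ← natCast_zsmul, ← mul_smul]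

/-- **The exterior derivative of a monomial vector in the monomial basis** (integer matrix):
`d (E (α, s)) = ∑_{i ∉ s} (α_i ε(s, i)) • E (α - e_i, insert i s)` (terms with `i ∈ s` vanish, and so do
those with `α_i = 0`). [cite: Illusie1979, 0.2] -/
theorem dTwist_twistFormBasis (h : IsPBasis p t) (n : ℕ) (α : ι → Fin p) (s : Set.powersetCard ι n) :
    dTwist p R n (h.twistFormBasis n (α, s)) =
      ∑ i, if hi : i ∉ (s : Finset ι) then
        (((α i : ℕ) : ℤ) * ((insertSign (s : Finset ι) i : ℤˣ) : ℤ)) •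
          h.twistFormBasis (n + 1) (α - Pi.single i 1, insertIdx s i hi)
      else 0 := by
  rw [dTwist_twistFormBasis_eq_of_sum, map_sum]
  refine Finset.sum_congr rfl fun i _ => ?_
  by_cases hi : i ∉ (s : Finset ι)
  · rw [dif_pos hi, h.ιMul_D_formBasis_of_not_mem n s i hi, natCast_mul_smul_zsmul, map_zsmul,
      twistFormBasis_apply]
  · rw [dif_neg hi, h.ιMul_D_formBasis_of_mem n s i (not_not.1 hi), smul_zero, map_zero]

end IsPBasis

end Literature.NumberTheory.GaloisCohomology

end
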